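import Summits.NavierStokesRegularity.NavierStokesRegularity.Theses.AdaptedFrequency
import Literature.Analysis.FluidPDE.AdaptedBackwardKernel
import Summits.NavierStokesRegularity.NavierStokesRegularity.Theorems.AdaptedFrequencyAdaptedFrequencyConvergesStubPinchingLower
import Summits.NavierStokesRegularity.NavierStokesRegularity.Theorems.AdaptedFrequencyAdaptedFrequencyConvergesStubFrequencyCeiling
import Summits.NavierStokesRegularity.NavierStokesRegularity.Theorems.AdaptedFrequencyAdaptedFrequencyConvergesStubEnstrophyC2

/-!
# `AdaptedFrequencyConverges` reduces to eventual monotonicity of the adapted frequency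
(crux stmt-NavierStokesRegularity-10493, line `unsteadiness-squeeze`, lead's composition)

Sorry-free REDUCTION theorem of the line (lands `--supports stmt-NavierStokesRegularity-10493`):
`adaptedFrequencyConverges_of_bandExclusion` — if, under the crux hypotheses (classical NS on
`ℝ³ × [0,T)`, Leray–Hopf from a rapidly decaying datum, Type-I rate, `(T, x₀)` backward-singular,
`G` a Gaussian-comparable flow-adapted backward kernel on `[t₀, T)`) and above an enstrophy floor
`c ≤ (T−t)² H`, the rebuilt band polynomial `P τ = (T − τ)·Λ′(τ)` (`= dΛ/ds`, `s = −log(T−t)`) is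
nonnegative on a final window — the line's only open stub `stub_bandExclusion`, verbatim as
registered — then the crux `AdaptedFrequency.AdaptedFrequencyConverges` holds.

Proof = the line's composition over its LANDED stubs: the floor
(`TauberianOmegaLimit.stub_pinchingLower`, p82804), the ceiling `Λ ≤ M`
(`UnsteadinessSqueeze.stub_frequencyCeiling`, p96525), second-order kernel calculus
`H ∈ C²` near `T` (`UnsteadinessSqueeze.stub_enstrophyC2`, p103653) which with the floor makes
`Λ = (T−t)H′/H` of class `C¹` so that `∫ₜ^{t'} Λ′ = Λ t' − Λ t` (upper jaw, real analysis below);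
band exclusion then makes `Λ` non-decreasing on a final window, and a non-decreasing function
bounded above has a left limit at `T`.  The converse fails in general (a convergent `Λ` need not
be eventually monotone), so unlike `tauberian-omega-limit`'s `stub_slowDecrease` (⇔ crux) this stub
is STRICTLY stronger than the crux; see `…/Negative/BandExclusionHiddenMonotonicity.lean` for what
it secretly asserts (a Giga–Kohn-type monotone quantity `(T−t)² H ↓`).
Sources: Agmon–Nirenberg, CPAM 16 (1963) (log-convexity / second variation); Poon, Comm. PDE 21
(1996); idea card `Cruxes/AdaptedFrequencyConverges/Ideas/unsteadiness-squeeze.md`.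
-/

noncomputable section

namespace Summit.NavierStokesRegularity.NavierStokesRegularity.Theorems.AdaptedFrequencyConverges.UnsteadinessSqueeze

open scoped Topology
open Literature.Analysis.FluidPDE Set Filter MeasureTheory
open Summit.NavierStokesRegularity.NavierStokesRegularity.Theses.AdaptedFrequency

/-- **Real-analysis core of the upper jaw.** If `H` is `C²` and positive on `(a, T)`, then
`Λ t = (T − t) H′(t)/H(t)` is `C¹` there, so on every `[t, t'] ⊂ (a, T)` its derivative is
interval-integrable and `∫ₜ^{t'} Λ′ = Λ t' − Λ t`. -/
theorem upperJaw_of_contDiffOn {H : ℝ → ℝ} {a T : ℝ}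
    (hC2 : ContDiffOn ℝ 2 H (Ioo a T)) (hpos : ∀ t ∈ Ioo a T, 0 < H t) {t t' : ℝ}
    (hat : a < t) (htt' : t ≤ t') (ht'T : t' < T) :
    IntervalIntegrable (fun τ => deriv (fun s => (T - s) * deriv H s / H s) τ) volume t t' ∧
      ∫ τ in t..t', deriv (fun s => (T - s) * deriv H s / H s) τ =
        (T - t') * deriv H t' / H t' - (T - t) * deriv H t / H t := by
  have hopen : IsOpen (Ioo a T) := isOpen_Ioo
  -- `H′` is `C¹` on the window
  have hH1 : ContDiffOn ℝ 1 (deriv H) (Ioo a T) := by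
    have h2 : ContDiffOn ℝ (1 + 1) H (Ioo a T) := by
      simpa [show ((1 : WithTop ℕ∞) + 1) = 2 by norm_num] using hC2
    exact ((contDiffOn_succ_iff_deriv_of_isOpen hopen).1 h2).2.2
  have hH1' : ContDiffOn ℝ 1 H (Ioo a T) := hC2.of_le (by norm_num)
  -- `Λ` is `C¹` on the window
  have hΛ : ContDiffOn ℝ 1 (fun s => (T - s) * deriv H s / H s) (Ioo a T) := by
    refine ContDiffOn.div ?_ hH1' (fun s hs => (hpos s hs).ne')
    exact (contDiffOn_const.sub contDiffOn_id).mul hH1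
  have hΛd : DifferentiableOn ℝ (fun s => (T - s) * deriv H s / H s) (Ioo a T) :=
    hΛ.differentiableOn one_ne_zero
  have hΛ' : ContinuousOn (deriv fun s => (T - s) * deriv H s / H s) (Ioo a T) := by
    have h1 : ContDiffOn ℝ (0 + 1) (fun s => (T - s) * deriv H s / H s) (Ioo a T) := by
      simpa using hΛ
    exact (((contDiffOn_succ_iff_deriv_of_isOpen hopen).1 h1).2.2).continuousOn
  have hsub : uIcc t t' ⊆ Ioo a T := by
    rw [uIcc_of_le htt']
    exact fun s hs => ⟨hat.trans_le hs.1, hs.2.trans_lt ht'T⟩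
  have hint : IntervalIntegrable (fun τ => deriv (fun s => (T - s) * deriv H s / H s) τ)
      volume t t' :=
    (hΛ'.mono hsub).intervalIntegrable
  refine ⟨hint, ?_⟩
  exact intervalIntegral.integral_deriv_eq_sub
    (fun s hs => (hΛd s (hsub hs)).differentiableAt (hopen.mem_nhds (hsub hs))) hint

/-- **Upper jaw** (the planner's `stub_upperJaw` with the rebuilt band polynomial
`P τ/(T−τ) = Λ′(τ)`): under the crux hypotheses and above an enstrophy floor, on late windows `Λ′`
is interval-integrable and `∫ₜ^{t'} Λ′ ≤ Λ t' − Λ t` (indeed `=`). From the landed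
`stub_enstrophyC2` and `upperJaw_of_contDiffOn`. -/
theorem upperJaw :
    ∀ (ν T : ℝ) (u : ℝ → EuclideanSpace ℝ (Fin 3) → EuclideanSpace ℝ (Fin 3)) (p : ℝ → EuclideanSpace ℝ (Fin 3) → ℝ) (x₀ : EuclideanSpace ℝ (Fin 3)) (t₀ : ℝ) (G : ℝ → EuclideanSpace ℝ (Fin 3) → ℝ), 0 < ν → 0 < T → IsClassicalNSSolutionOn (Ico 0 T) ν 0 u p → IsLerayHopfOn T ν 0 (u 0) u → HasRapidSpatialDecay (u 0) → IsTypeIBlowup u T → t₀ ∈ Ico 0 T → (∀ r : ℝ, 0 < r → eLpNorm (Function.uncurry u) ⊤ (volume.restrict (parabolicCylinder r (T, x₀))) = ⊤) → IsAdaptedBackwardKernel ν u (Ico t₀ T) T x₀ G → IsGaussianComparable G (Ico t₀ T) T x₀ → ∀ (t₁ c : ℝ), t₁ ∈ Ico t₀ T → 0 < c → (∀ t ∈ Ico t₁ T, c ≤ (T - t) ^ 2 * adaptedEnstrophy u G t) → ∃ t₂ ∈ Ico t₁ T, ∀ t t' : ℝ, t₂ ≤ t → t ≤ t' → t' < T →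 IntervalIntegrable (fun τ => deriv (adaptedFrequency u G T) τ) volume t t' ∧ ∫ τ in t..t', deriv (adaptedFrequency u G T) τ ≤ adaptedFrequency u G T t' - adaptedFrequency u G T t := by
  intro ν T u p x₀ t₀ G hν hT hcl hLH hdec hTI ht₀ hsing hker hcmp t₁ c ht₁ hc hfloor
  obtain ⟨a, ha, hC2⟩ := stub_enstrophyC2 ν T u p x₀ t₀ G hν hT hcl hLH hdec hTI ht₀ hsing hker hcmp
  -- the window `(a', T)`, `a' = max a t₁`, on which `H` is `C²` and positive
  set a' : ℝ := max a t₁ with ha'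
  have hC2' : ContDiffOn ℝ 2 (adaptedEnstrophy u G) (Ioo a' T) :=
    hC2.mono (Ioo_subset_Ioo_left (le_max_left _ _))
  have hpos : ∀ t ∈ Ioo a' T, 0 < adaptedEnstrophy u G t := by
    intro t ht
    have h1 : c ≤ (T - t) ^ 2 * adaptedEnstrophy u G t :=
      hfloor t ⟨(le_max_right _ _).trans ht.1.le, ht.2⟩
    have h2 : 0 < (T - t) ^ 2 := by
      have : 0 < T - t := sub_pos.2 ht.2
      positivity
    by_contra hle
    push Not at hle
    have : (T - t) ^ 2 * adaptedEnstrophy u G t ≤ 0 :=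
      mul_nonpos_of_nonneg_of_nonpos h2.le hle
    linarith
  refine ⟨(a' + T) / 2, ⟨?_, by linarith [max_lt ha.2 ht₁.2]⟩, ?_⟩
  · have : t₁ ≤ a' := le_max_right _ _
    linarith [max_lt ha.2 ht₁.2]
  intro t t' h2t htt' ht'T
  have hat : a' < t := by linarith [max_lt ha.2 ht₁.2]
  have key := upperJaw_of_contDiffOn hC2' hpos hat htt' ht'T
  have hfun : adaptedFrequency u G T =
      fun s => (T - s) * deriv (adaptedEnstrophy u G) s / adaptedEnstrophy u G s := by
    funext s; rfl
  rw [hfun]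
  exact ⟨key.1, key.2.le⟩

/-- **The crux reduces to band exclusion** (line `unsteadiness-squeeze`): if under the crux
hypotheses and above any enstrophy floor the adapted frequency satisfies `(T − τ)·Λ′(τ) ≥ 0` on a
final window `[t₂, T)` (the line's registered `stub_bandExclusion`, verbatim), then
`AdaptedFrequencyConverges` holds: floor (landed) + upper jaw (landed second-order kernel
calculus + FTC) + band exclusion make `Λ` non-decreasing near `T`, the landed ceiling bounds it
above, and a bounded non-decreasing function has a left limit at `T`. -/
theorem adaptedFrequencyConverges_of_bandExclusion : (∀ (ν T : ℝ) (u : ℝ → EuclideanSpace ℝ (Fin 3) → EuclideanSpace ℝ (Fin 3)) (p : ℝ → EuclideanSpace ℝ (Fin 3) → ℝ) (x₀ : EuclideanSpace ℝ (Fin 3)) (t₀ : ℝ) (G : ℝ → EuclideanSpace ℝ (Fin 3) → ℝ), 0 < ν → 0 < T → IsClassicalNSSolutionOn (Ico 0 T) ν 0 u p → IsLerayHopfOn T ν 0 (u 0) u → HasRapidSpatialDecay (u 0) → IsTypeIBlowup u T → t₀ ∈ Ico 0 T → (∀ r : ℝ, 0 < r → eLpNorm (Function.uncurry u) ⊤ (volume.restrict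 (parabolicCylinder r (T, x₀))) = ⊤) → IsAdaptedBackwardKernel ν u (Ico t₀ T) T x₀ G → IsGaussianComparable G (Ico t₀ T) T x₀ → ∀ (t₁ c : ℝ), t₁ ∈ Ico t₀ T → 0 < c → (∀ t ∈ Ico t₁ T, c ≤ (T - t) ^ 2 * adaptedEnstrophy u G t) → ∃ t₂ ∈ Ico t₁ T, ∀ τ ∈ Ico t₂ T, 0 ≤ (T - τ) * deriv (adaptedFrequency u G T) τ) → AdaptedFrequencyConverges := by
  intro hBE ν T hν hT u p hcl hLH hdec hTI x₀ t₀ G ht₀ hsing hK hcomp H Λ hH hΛ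
  have hker : IsAdaptedBackwardKernel ν u (Ico t₀ T) T x₀ G := isAdaptedBackwardKernel_iff.2 hK
  have hcmp : IsGaussianComparable G (Ico t₀ T) T x₀ := isGaussianComparable_iff_fin_three.2 hcomp
  -- `H` is the adapted enstrophy, `Λ` the adapted frequency
  have hH' : H = adaptedEnstrophy u G := by
    rw [hH]; funext t; rfl
  have hΛ' : Λ = adaptedFrequency u G T := by
    rw [hΛ, hH']; funext t; rfl
  rw [hΛ']
  -- floor
  obtain ⟨t₁, ht₁, c, hc, hfloor⟩ :=
    Summit.NavierStokesRegularity.NavierStokesRegularity.Theorems.AdaptedFrequencyConverges.TauberianOmegaLimit.stub_pinchingLower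
      ν T u p x₀ t₀ G hν hT hcl hLH hdec hTI ht₀ hsing hker hcmp
  -- upper jaw and band exclusion above the floor
  obtain ⟨t₂, ht₂, hjaw⟩ :=
    upperJaw ν T u p x₀ t₀ G hν hT hcl hLH hdec hTI ht₀ hsing hker hcmp t₁ c ht₁ hc hfloor
  obtain ⟨t₃, ht₃, hband⟩ :=
    hBE ν T u p x₀ t₀ G hν hT hcl hLH hdec hTI ht₀ hsing hker hcmp t₁ c ht₁ hc hfloor
  -- ceiling
  obtain ⟨t₄, ht₄, M, hceil⟩ :=
    stub_frequencyCeiling ν T u p x₀ t₀ G hν hT hcl hLH hdec hTI ht₀ hsing hker hcmp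
  -- a common final window `(t₅, T)`
  set t₅ : ℝ := max (max t₂ t₃) t₄ with ht₅
  have ht₅T : t₅ < T := max_lt (max_lt ht₂.2 ht₃.2) ht₄.2
  have h25 : t₂ ≤ t₅ := (le_max_left _ _).trans (le_max_left _ _)
  have h35 : t₃ ≤ t₅ := (le_max_right _ _).trans (le_max_left _ _)
  have h45 : t₄ ≤ t₅ := le_max_right _ _
  -- `Λ′ ≥ 0` on the window
  have hderiv : ∀ τ ∈ Ioo t₅ T, 0 ≤ deriv (adaptedFrequency u G T) τ := by
    intro τ hτ
    have h1 : 0 ≤ (T - τ) * deriv (adaptedFrequency u G T) τ :=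
      hband τ ⟨h35.trans hτ.1.le, hτ.2⟩
    have h2 : 0 < T - τ := sub_pos.2 hτ.2
    exact (mul_nonneg_iff_of_pos_left h2).1 h1
  -- `Λ` is non-decreasing on the window
  have hmono : MonotoneOn (adaptedFrequency u G T) (Ioo t₅ T) := by
    intro t ht t' ht' htt'
    obtain ⟨_, hle⟩ := hjaw t t' (h25.trans ht.1.le) htt' ht'.2
    have hnn : 0 ≤ ∫ τ in t..t', deriv (adaptedFrequency u G T) τ :=
      intervalIntegral.integral_nonneg htt' fun τ hτ =>
        hderiv τ ⟨ht.1.trans_le hτ.1, hτ.2.trans_lt ht'.2⟩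
    linarith
  -- `Λ` is bounded above on the window
  have hbdd : BddAbove (adaptedFrequency u G T '' Ioo t₅ T) := by
    refine ⟨M, ?_⟩
    rintro _ ⟨t, ht, rfl⟩
    exact hceil t ⟨h45.trans ht.1.le, ht.2⟩
  exact ⟨_, MonotoneOn.tendsto_nhdsWithin_Ioo_left (nonempty_Ioo.2 ht₅T) hmono hbdd⟩

end Summit.NavierStokesRegularity.NavierStokesRegularity.Theorems.AdaptedFrequencyConverges.UnsteadinessSqueeze

end
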